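import Literature.MathematicalPhysics.QuantumFieldTheory.Balaban1983to89.B8Prop6DentedCubeMemberScalarGammaOfNamedFacts
import Literature.MathematicalPhysics.QuantumFieldTheory.Balaban1983to89.B8Eq198DentedCubeMemberOfReal12
import Literature.MathematicalPhysics.QuantumFieldTheory.Balaban1983to89.B8Real1DentedCubeMember

/-!
# `Balaban1983to89.B8Prop6DentedCubeMemberScalarGammaOfGBound` — [Balaban1985RegularSpaces] PROPOSITION 6 (p. 99) AS `Node00.GaugedBoundB8D` AT A DENTED CUBE MEMBER:
# THE REAL INPUT OF THE (β) CROWN REDUCED TO (1.101) FOR `T⁻¹` AND THE 𝒢-BOUND ([Balaban1985BackgroundPropagators] THEOREMS 3.1, 3.2) ON THE DENTED MEMBER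

statement-level skeleton of published theorems with citation tags; proofs where landed; nothing here is a claim about the
Yang–Mills mass gap

PDF held: `paper:balaban1985-cmp99-regular-spaces-gauge-fixing`; (1.91)–(1.92) p. 91, (1.98) p. 92 («from Theorems 3.1, 3.2 of [4] it follows …»), (1.101) p. 93, Prop. 6 p. 99,
p. 98; [4] = `[Balaban1985BackgroundPropagators]` Thm 3.1 (3.47), Thm 3.2 (3.48) p. 398, Thm 3.3 p. 399; `[Balaban1985Variational]` ("[15]") (148)–(152) p. 301.

CITATION HEADER (lean-in-tree rule).  Cell `pub-ymgap` (HUMAN RULING D-0062, Track A), DAG node N05 = [B8], seat `pub-ymgap-dag-n05-e` (g31; FAN-OUT §N05 row s3b,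
Proposition-6 lane; the (β) road over NODE 00's dented datum `Node00.CubeB8D`, p655171).  WHY THIS FILE.  The crown `B8Prop6DentedCubeMemberScalarGammaOfNamedFacts`
((d3)-13) gives `GaugedBoundB8D` at every dented member of print's sub-lattice modulo TWO dented named facts, the second being the whole REAL triple
`Real123DentedCubeMemberPrinted` ((d3)-12).  dag-n05-c's pure `B8Prop6CubeMemberRealOfGBound.prop6_real123_of_gbound_printed` shows the triple is ALGEBRA over (1.101) for
`T⁻¹` (REAL-1 ∕ REAL-1′, [4] Thm 3.1) and the 𝒢-bound ([4] Thm 3.2); with the dented reductions (d3)-14 `real2_of_real1_gbound_dented` and (d3)-15 `real3_of_real1_real2_dented`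
THIS FILE repeats that composition on the dented member: ★ `real123Dented_of_real1_gbound : Real1DentedCubeMemberPrinted d ℓ → Real1M4DentedCubeMemberPrinted d ℓ →
GBoundDentedCubeMemberPrinted d ℓ → Real123DentedCubeMemberPrinted d ℓ` (§1; proof = the pure one's with the dented lemmas, cells rewritten by `lamST_top`), and ★★★
`gaugedBoundB8D_dentedMember_scalar_γ_of_gboundDented` (§2): the crown's §3 with its REAL hypothesis so reduced — `GaugedBoundB8D` at every dented member of the sub-lattice
(odd `L ≥ 5`, `d ≥ 2`) MODULO THREE single-theorem dented named facts: `Ineq159FlatDentedCubeMemberPrinted d L` ([4] Thm 3.3 ∕ (1.59)♭, p659892), `Real1DentedCubeMemberPrinted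
(d−1) (L−1)` + `Real1M4DentedCubeMemberPrinted (d−1) (L−1)` ([4] Thm 3.1 ∕ (1.101), (d3)-16) and `GBoundDentedCubeMemberPrinted (d−1) (L−1)` ([4] Thm 3.2, p661669).
Kind «kernel-checked proof», theorems only, no `def`.

HONEST SCOPE ∕ A6.  CONDITIONAL theorems on the displayed OPEN named facts; by-name compositions and matrix algebra; NO new estimate; nothing of [4]∕[6]∕[15] asserted as
proved; LOCATED-CARRIER caveat as in the pure crown.  Count-neutral; N05 ∕ N07 NOT discharged; FLAG №4 open; one finite `𝕋⁴` programme at fixed `ε`, Bałaban as printed;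
nothing continuum ∕ ℝ⁴ ∕ OS ∕ mass-gap ∕ Clay.  No `sorry`, no `def`, no `instance`, no `notation`.  Unit `pub-ymgap-dag-n05-e` (g31), 2026-08-28.

RELATED IN THE TREE, NOT DUPLICATED (`rg` 2026-08-28T21:05Z: `ls Balaban1983to89 | grep -ci 'DentedCubeMemberScalarGammaOfGBound'` = 0): the pure models
`B8Prop6CubeMemberRealOfGBound` ∕ `B8Thm32GBoundCubeMember.prop6_real123_printed_of_GBound` ∕ `B8Prop6CubeMemberScalarGammaOfGBound`; the inputs named above (USED).
-/

noncomputable section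

open NormedSpace

namespace Literature.MathematicalPhysics.QuantumFieldTheory.Balaban1983to89.B8Prop6DentedCubeMemberScalarGammaOfGBound

open scoped Matrix
open B7Prop1Explicit B7Prop2Explicit B7Prop1Local
open B8Ineq132 (InAk)
open B8Eq140Level (SideTouches)
open B8LambdaSpaceKLevel (wt)
open B8Eq1101CubeMemberWeights (awPrinted wPrinted awPrinted_facts wPrinted_facts)
open B8Thm32GBoundDentedCubeMember (GBoundDentedCubeMemberPrinted)
open B8Real123DentedCubeMember (Real123DentedCubeMemberPrinted)
open B8Real1DentedCubeMember (Real1DentedCubeMemberPrinted Real1M4DentedCubeMemberPrinted)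
open B8Ineq159FlatDentedCubeMemberPrinted (Ineq159FlatDentedCubeMemberPrinted)
open B8DentedCubeMemberZd (lamST_top)
open B8Eq192DentedCubeMemberOfReal1G (real2_of_real1_gbound_dented)
open B8Eq198DentedCubeMemberOfReal12 (real3_of_real1_real2_dented)
open B8Prop6DentedCubeMemberScalarGammaOfNamedFacts (gaugedBoundB8D_dentedMember_scalar_γ_of_dentedNamedFacts)
open Node00 (CubeB8D GaugedBoundB8D)
open Literature.MathematicalPhysics.QuantumLattice (blockMap)

export B7Prop1Explicit (Site)

variable {d : ℕ}

/-! ## §1 The REAL triple at the top truncation of a dented member from REAL-1, REAL-1′ and the 𝒢-bound there -/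

open Classical in
/-- ★ **THE FLAT CONSUMER's THREE REAL FAMILIES AT THE TOP TRUNCATION OF A DENTED MEMBER ARE ALGEBRA OVER (1.101) FOR `T⁻¹` AND THE 𝒢-BOUND THERE** — the dented twin of
dag-n05-c's `prop6_real123_of_gbound_printed` ∕ `prop6_real123_printed_of_GBound`: REAL-1 verbatim (`B_G`), REAL-2 by (d3)-14 `real2_of_real1_gbound_dented`
(`B′₀ᴴ = B_G·B_G′·C_𝒢 + B_G`, `B′₂ = B_G′·C_𝒢 + 8`), REAL-3 by (d3)-15 `real3_of_real1_real2_dented` (`B_R = 1 + (B′₂ + 8)·B_G`), at print's weights (`a_max = 8` from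
`awPrinted_facts ∕ wPrinted_facts`); thresholds = maxima.  CONDITIONAL on the three named dented facts.
[cite: Balaban1985RegularSpaces, (1.91)–(1.92) p.91, (1.98) p.92, (1.101) p.93, (1.31) p.82; Balaban1985BackgroundPropagators, Theorem 3.1 (3.47) p.398, Theorem 3.2 (3.48) p.398; Balaban1985Variational, (148)–(151) p.301] -/
theorem real123Dented_of_real1_gbound (d ℓ : ℕ) (hℓ : 1 ≤ ℓ) (h1 : Real1DentedCubeMemberPrinted d ℓ) (h1' : Real1M4DentedCubeMemberPrinted d ℓ)
    (hG : GBoundDentedCubeMemberPrinted d ℓ) : Real123DentedCubeMemberPrinted d ℓ := by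
  obtain ⟨BG, ρ₁, M₁, N₁, hBG, R1⟩ := h1
  obtain ⟨BG', ρ₂, M₂, N₂, hBG', R1'⟩ := h1'
  obtain ⟨CG, ρ₃, M₃, N₃, hCG, G⟩ := hG
  refine ⟨BG, BG * (BG' * CG) + BG, BG' * CG + 8, 1 + ((BG' * CG + 8) + 8) * BG, max (max ρ₁ ρ₂) ρ₃, max (max M₁ M₂) M₃, max (max N₁ N₂) N₃,
    hBG, by positivity, by positivity, by positivity, ?_⟩
  intro η hη Mh hMh hM0 K' Ω c R hρd hMd hRρ hR2 hRN hρbig hΩ S hS B hB K hK T hT Q hQ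
  have hL : 1 ≤ ℓ + 1 := Nat.succ_pos ℓ
  have hη0 : η ≠ 0 := hη.ne'
  -- thresholds
  have hM₁ : M₁ ≤ ((ℓ : ℝ) + 1) * Mh := ((le_max_left _ _).trans (le_max_left _ _)).trans hM0
  have hM₂ : M₂ ≤ ((ℓ : ℝ) + 1) * Mh := ((le_max_right _ _).trans (le_max_left _ _)).trans hM0
  have hM₃ : M₃ ≤ ((ℓ : ℝ) + 1) * Mh := (le_max_right _ _).trans hM0
  have hN₁ : N₁ + 1 ≤ R * ((ℓ + 1) * Mh) := le_trans (Nat.succ_le_succ ((le_max_left _ _).trans (le_max_left _ _))) hRN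
  have hN₂ : N₂ + 1 ≤ R * ((ℓ + 1) * Mh) := le_trans (Nat.succ_le_succ ((le_max_right _ _).trans (le_max_left _ _))) hRN
  have hN₃ : N₃ + 1 ≤ R * ((ℓ + 1) * Mh) := le_trans (Nat.succ_le_succ (le_max_right _ _)) hRN
  have hρ₁ : ρ₁ ≤ (c.ρ : ℝ) := ((le_max_left _ _).trans (le_max_left _ _)).trans hρbig
  have hρ₂ : ρ₂ ≤ (c.ρ : ℝ) := ((le_max_right _ _).trans (le_max_left _ _)).trans hρbig
  have hρ₃ : ρ₃ ≤ (c.ρ : ℝ) := (le_max_right _ _).trans hρbig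
  -- REAL-1, REAL-1′ and the 𝒢-bound at this datum (named dented facts)
  have hR1 := R1 η hη Mh hMh hM₁ K' Ω c R hρd hMd hRρ hR2 hN₁ hρ₁ hΩ S hS K hK T hT
  have hR1' := R1' η hη Mh hMh hM₂ K' Ω c R hρd hMd hRρ hR2 hN₂ hρ₂ hΩ S hS K hK T hT
  have hGB := G η hη Mh hMh hM₃ K' Ω c R hρd hMd hRρ hR2 hN₃ hρ₃ hΩ S hS B hB K hK T hT Q hQ
  -- the weights: nonnegative, normalised size `≤ 8`
  obtain ⟨hwin, -, -, -⟩ := awPrinted_facts hℓ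
  obtain ⟨hwpos, -, hwwin⟩ := wPrinted_facts d hℓ hη
  have hw0 : ∀ j, 0 ≤ wPrinted d ℓ η j := fun j => (hwpos j).le
  have hamax : ∀ j, j ≤ c.k → wPrinted d ℓ η j * η ^ 2 * ((((ℓ + 1 : ℕ) : ℝ)) ^ j) ^ 2 * (((((ℓ + 1 : ℕ) : ℝ)) ^ (d + 1)) ^ j)⁻¹ ≤ 8 := by
    intro j _
    rw [hwwin j]
    rcases Nat.eq_zero_or_pos j with h0 | hp
    · subst h0; norm_num [awPrinted]
    · exact (hwin j hp).2
  -- the cells in the truncation letter `c.lamST c.k = c.lamS`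
  have hB' := hB
  have hK' := hK
  rw [← lamST_top c] at hB' hK'
  -- REAL-2 from (d3)-14
  have hR2 : ∀ (X : ↥B → ℝ) (s : ℝ), 0 ≤ s → (∀ p', |X p'| ≤ s) →
      ∀ φ : (Fin (d + 1) → ℤ) → ℝ, (∀ x, x ∉ c.sq 0 → φ x = 0) →
        (∀ v : ↥S, φ v.1 = ∑ p' : ↥B, (T⁻¹ * (T⁻¹ * Qᵀ) * (Q * T⁻¹ * T⁻¹ * Qᵀ)⁻¹) v p' * X p') →
        (∀ x, |φ x| ≤ BG * (BG' * CG) * s) ∧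
        (∀ j, j ≤ c.k → ∀ p ∈ {b : (Fin (d + 1) → ℤ) × Fin (d + 1) | SideTouches (c.sq j) b.1 b.2},
          wt (ℓ + 1) η j * |η⁻¹ * (φ (p.1 + e p.2) - φ p.1)| ≤ BG * (BG' * CG) * s) ∧
        (∀ j, j ≤ c.k → ∀ x ∈ c.sq j,
          wt (ℓ + 1) η j ^ 2 * |∑ μ : Fin (d + 1), (η ^ 2)⁻¹ * (2 * φ x - φ (x + e μ) - φ (x - e μ))| ≤ (BG' * CG + 8) * s) :=
    fun X s hs hXs φ hφ0 hφS =>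
      real2_of_real1_gbound_dented hL c le_rfl hη0 (wPrinted d ℓ η) hw0 (by norm_num) hamax S hS B hB' K hK' T hT Q hQ hBG'.le hCG
        hR1 hR1' hGB X s hs hXs φ hφ0 hφS
  refine ⟨hR1, fun X s hs hXs φ hφ0 hφS => ?_, ?_⟩
  · obtain ⟨hf, hg, hΔ⟩ := hR2 X s hs hXs φ hφ0 hφS
    have hmono : BG * (BG' * CG) * s ≤ (BG * (BG' * CG) + BG) * s := by nlinarith
    exact ⟨fun x => (hf x).trans hmono, fun j hj p hp => (hg j hj p hp).trans hmono, hΔ⟩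
  · intro ρ' r hr hρ' j hj v hv
    exact real3_of_real1_real2_dented hL c le_rfl hη0 (wPrinted d ℓ η) hw0 (by norm_num) hamax S hS B hB' K hK' T hT Q hQ hBG.le
      (fun ρ' r hr hρ' φ hφ0 hφS => (hR1 ρ' r hr hρ' φ hφ0 hφS).1)
      (fun X s hs hXs φ hφ0 hφS => ⟨(hR2 X s hs hXs φ hφ0 hφS).1, (hR2 X s hs hXs φ hφ0 hφS).2.2⟩)
      ρ' r hr hρ' j hj v hv

#print axioms real123Dented_of_real1_gbound

variable {𝔸 : Type} [CStarAlgebra 𝔸] [Nontrivial 𝔸]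

/-! ## §2 The (β) crown modulo three single-theorem dented named facts -/

open Classical in
/-- ★★★ **PROPOSITION 6 (p. 99) AS `Node00.GaugedBoundB8D` AT EVERY DENTED CUBE MEMBER OF PRINT's BIG-BLOCK SUB-LATTICE, FOR ODD `L ≥ 5` AND `d ≥ 2`, MODULO (1.59)♭,
(1.101) AND THE 𝒢-BOUND ON THE DENTED MEMBER** — the crown's `gaugedBoundB8D_dentedMember_scalar_γ_of_dentedNamedFacts` with its REAL hypothesis REDUCED by §1:
remaining hypotheses, all OPEN named facts on [15]'s dented sequence `{Ω′_j}` at its top truncation and each the statement of ONE printed theorem there —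
`Ineq159FlatDentedCubeMemberPrinted d L` ([4] Thm 3.3 at `U = 1` ∕ [B8] (1.59)♭), `Real1DentedCubeMemberPrinted (d−1) (L−1)` and `Real1M4DentedCubeMemberPrinted (d−1) (L−1)`
([4] Thm 3.1 ∕ [B8] (1.101) for `T⁻¹`), `GBoundDentedCubeMemberPrinted (d−1) (L−1)` ([4] Thm 3.2 (3.48)).  Conclusion verbatim the crown's.
[cite: Balaban1985RegularSpaces, Prop. 6 (1.135)–(1.138) p.99, p.98, (1.59) p.86, (1.91)–(1.92) p.91, (1.98) p.92, (1.101) p.93; Balaban1985Variational, (148)–(152) p.301; Balaban1985BackgroundPropagators, Thms 3.1–3.3 pp.398–399; Balaban1984PropagatorsII, Prop. 2.6 (2.136) p.247, Prop. 2.3 (2.87) p.238] -/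
theorem gaugedBoundB8D_dentedMember_scalar_γ_of_gboundDented (hd2 : 2 ≤ d) {L : ℕ} (hL5 : 5 ≤ L) (hodd : Odd L)
    (h159D : Ineq159FlatDentedCubeMemberPrinted d L) (hR1 : Real1DentedCubeMemberPrinted (d - 1) (L - 1))
    (hR1' : Real1M4DentedCubeMemberPrinted (d - 1) (L - 1)) (hG : GBoundDentedCubeMemberPrinted (d - 1) (L - 1)) :
    ∃ B₀ c₁ ρ₀ M₀ : ℝ, ∃ N₀ R₀ : ℕ, 1 ≤ B₀ ∧ 0 < c₁ ∧ ∀ (η : ℝ), 0 < η → ∀ {K : ℕ} {Ω : ℕ → Set (Site d)} (c : CubeB8D d L K Ω),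
      -- PRINT'S SIDE CONDITIONS (p. 98) on the cube datum in the named facts' letters (`M_h = Lˢ`), above threshold
      ∀ (s R : ℕ), 3 ≤ L ^ s → M₀ ≤ (L : ℝ) ^ (s + 1) → L ^ (s + 1) ∣ c.ρ → L ^ (s + 1) ∣ c.M → R * L ^ (s + 1) ≤ c.ρ → 2 * L ≤ R →
        R₀ ≤ R → N₀ + 1 ≤ R * L ^ (s + 1) → ρ₀ ≤ (c.ρ : ℝ) →
      -- THE DENT PREMISE ([6] (1.4)₂): `Ω_k` is a union of cubes of side `L^{s+1}Lᵏ` of the grid anchored at `□_k`'s fine lower corner `Lᵏ(c.a − c.ρ)`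
      (∀ x y : Site d,
          blockMap (L ^ (s + 1) * L ^ c.k) (x - fun i => (L : ℤ) ^ c.k * (c.a i - c.ρ)) =
            blockMap (L ^ (s + 1) * L ^ c.k) (y - fun i => (L : ℤ) ^ c.k * (c.a i - c.ρ)) → x ∈ Ω c.k → y ∈ Ω c.k) →
      ∀ (U₀ : Site d → Fin d → 𝔸ˣ), (∀ x κ, U₀ x κ ∈ unitaryUnits 𝔸) → ∀ (α₀ : ℝ), 0 < α₀ → InAk L K η α₀ Ω U₀ →
      7 * d * (L : ℝ) ^ 2 * c.M * α₀ ≤ c₁ →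
      GaugedBoundB8D L η U₀ c (7 * d * (L : ℝ) ^ 2 * (5 * (d : ℝ) * L * B₀) * c.M * α₀) :=
  gaugedBoundB8D_dentedMember_scalar_γ_of_dentedNamedFacts (𝔸 := 𝔸) hd2 hL5 hodd h159D
    (real123Dented_of_real1_gbound (d - 1) (L - 1) (by omega) hR1 hR1' hG)

#print axioms gaugedBoundB8D_dentedMember_scalar_γ_of_gboundDented

end Literature.MathematicalPhysics.QuantumFieldTheory.Balaban1983to89.B8Prop6DentedCubeMemberScalarGammaOfGBound

end
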